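import Mathlib
import Summits.Schanuel.Schanuel.Theorems.DiophantineDichotomyKhovanskiiApproxTypeEvLambertEndgame
import HarnessLib

/-!
# Route `DiophantineDichotomy`, crux `KhovanskiiApproxTypeEv` (stmt-Schanuel-14972), line `lambert-liouville-kill`:
# stub `stub_anchoredEndgame` — anchored (rank-3) endgame (scale `Δ`, Liouville exponent `m`, final inequality)

Crux `Summit.Schanuel.Schanuel.Theses.DiophantineDichotomy.KhovanskiiApproxTypeEv` (item stmt-Schanuel-14972),
certificate line `lambert-liouville-kill` (skeleton `Cruxes/KhovanskiiApproxTypeEv/Lines/lambert_liouville_kill.lean`,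
lead `prover-line-stmt-Schanuel-14972-a1-0`), registered stub `stub_anchoredEndgame` (landed `--supports stmt-Schanuel-14972`).

The final real inequality of the ANCHORED certificate `notLiouville_lambert_of_evAnchored`: for `a < 1/2`,
`C > 0`, `c ≥ 1`, `K ≥ 0` there is an AP scale `Δ ≥ c` such that for every height-window exponent
`M₀ > 0` some Liouville exponent `m` and threshold `q₀` make the challenger's distance
`max (H^{−Δ/c}) (K q^{−m})` beat the crux's bound `exp(−C(Dᵃ log H + Dᵇ))` for ALL degree budgets
`1 ≤ D ≤ (cΔ)² + 1`, uniformly over `q₀ ≤ q ≤ H ≤ q^{M₀}`.  Proof: with `s := max a 0 < 1/2`,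
`t := 1 − 2s > 0`, the scale `Δ := max c ((c(4Cc^{2s} + 2))^{1/t})` satisfies
`Δ/c = Δ^{2s} Δ^t / c ≥ Δ^{2s}(4Cc^{2s} + 2)` while `C((cΔ)² + 1)^s ≤ C(2(cΔ)²)^s ≤ 2Cc^{2s}Δ^{2s}`,
whence `C((cΔ)² + 1)^s + 2 ≤ Δ/c` (`anchoredEndgame_scale`); then `C Dᵃ log H ≤ (Δ/c − 2) log H` and,
for `q > exp(C((cΔ)² + 1)^{max b 0}/2)`, `C Dᵇ < 2 log q ≤ 2 log H` (`anchoredEndgame_height_entry`);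
finally with `m := ⌈M₀Δ/c⌉₊ + 1`, `q ≥ K + 1`: `K q^{−m} ≤ q^{1−m} ≤ q^{−M₀Δ/c} = (q^{M₀})^{−Δ/c} ≤ H^{−Δ/c}`
(`anchoredEndgame_liouville_entry`, the real-exponent version of the landed `endgame_liouville_entry`).
Pure Mathlib real analysis (`Real.rpow_add`, `Real.rpow_mul`, `Real.mul_rpow`, `Real.rpow_le_rpow`,
`Real.rpow_def_of_pos`, `Real.rpow_le_rpow_of_nonpos`).
-/

noncomputable section

-- `Summit.Schanuel.Schanuel.…` is the mandated summit/sub-problem namespace (single-conjunct summit), hence: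
set_option linter.dupNamespace false

namespace Summit.Schanuel.Schanuel.Cruxes.KhovanskiiApproxTypeEv.LambertLiouvilleKill

open Polynomial

/-- Choice of the AP scale: for `0 ≤ s < 1/2`, `C > 0`, `c ≥ 1` there is `Δ ≥ c` with
`C((cΔ)² + 1)^s + 2 ≤ Δ/c`.  Take `t := 1 − 2s > 0` and `Δ := max c ((c(4Cc^{2s} + 2))^{1/t})`:
then `Δ^t ≥ c(4Cc^{2s} + 2)`, so `Δ/c = Δ^{2s}Δ^t/c ≥ Δ^{2s}(4Cc^{2s} + 2)`, while
`((cΔ)² + 1)^s ≤ (2(cΔ)²)^s = 2^s c^{2s} Δ^{2s} ≤ 2c^{2s}Δ^{2s}` and `Δ^{2s} ≥ 1`. [folklore] -/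
theorem anchoredEndgame_scale (s C c : ℝ) (hs0 : 0 ≤ s) (hs : s < 1 / 2) (hC : 0 < C)
    (hc : 1 ≤ c) : ∃ Δ : ℝ, c ≤ Δ ∧ C * ((c * Δ) ^ 2 + 1) ^ s + 2 ≤ Δ / c := by
  set t : ℝ := 1 - 2 * s with ht
  have ht0 : 0 < t := by rw [ht]; linarith
  have hc0 : 0 < c := by linarith
  have hcs : 0 ≤ c ^ (2 * s) := Real.rpow_nonneg hc0.le _
  set X : ℝ := c * (4 * C * c ^ (2 * s) + 2) with hX
  have hX0 : 0 < X := by positivity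
  refine ⟨max c (X ^ (1 / t)), le_max_left _ _, ?_⟩
  set Δ : ℝ := max c (X ^ (1 / t)) with hΔ
  have hΔc : c ≤ Δ := le_max_left _ _
  have hΔ1 : 1 ≤ Δ := hc.trans hΔc
  have hΔ0 : 0 < Δ := by linarith
  -- `Δ ^ t ≥ X`
  have hΔt : X ≤ Δ ^ t := by
    have h1 : X ^ (1 / t) ≤ Δ := le_max_right _ _
    have h2 : (X ^ (1 / t)) ^ t ≤ Δ ^ t := Real.rpow_le_rpow (Real.rpow_nonneg hX0.le _) h1 ht0.le
    rwa [← Real.rpow_mul hX0.le, one_div_mul_cancel ht0.ne', Real.rpow_one] at h2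
  -- `Δ = Δ ^ (2s) * Δ ^ t`
  have hsplit : Δ ^ (2 * s) * Δ ^ t = Δ := by
    rw [← Real.rpow_add hΔ0]
    have h1 : 2 * s + t = 1 := by rw [ht]; ring
    rw [h1, Real.rpow_one]
  -- lower bound for `Δ / c`
  have hlow : Δ ^ (2 * s) * (4 * C * c ^ (2 * s) + 2) ≤ Δ / c := by
    rw [le_div_iff₀ hc0]
    calc Δ ^ (2 * s) * (4 * C * c ^ (2 * s) + 2) * c = Δ ^ (2 * s) * X := by rw [hX]; ring
      _ ≤ Δ ^ (2 * s) * Δ ^ t := mul_le_mul_of_nonneg_left hΔt (Real.rpow_nonneg hΔ0.le _)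
      _ = Δ := hsplit
  -- upper bound for `((cΔ)² + 1) ^ s`
  have hcΔ0 : 0 ≤ c * Δ := by positivity
  have hcΔ1 : 1 ≤ c * Δ := by nlinarith
  have hup : ((c * Δ) ^ 2 + 1) ^ s ≤ 2 * (c ^ (2 * s) * Δ ^ (2 * s)) := by
    have h0 : 1 ≤ (c * Δ) ^ 2 := by nlinarith
    have h1 : (c * Δ) ^ 2 + 1 ≤ 2 * (c * Δ) ^ 2 := by linarith
    have h2 : ((c * Δ) ^ 2 + 1) ^ s ≤ (2 * (c * Δ) ^ 2) ^ s :=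
      Real.rpow_le_rpow (by positivity) h1 hs0
    have h3 : (2 * (c * Δ) ^ 2) ^ s = 2 ^ s * (c ^ (2 * s) * Δ ^ (2 * s)) := by
      rw [Real.mul_rpow (by norm_num) (by positivity)]
      congr 1
      rw [← Real.mul_rpow hc0.le hΔ0.le, Real.rpow_mul hcΔ0, Real.rpow_two]
    have h4 : (2 : ℝ) ^ s ≤ 2 := by
      have h5 := Real.rpow_le_rpow_of_exponent_le (by norm_num : (1 : ℝ) ≤ 2) (show s ≤ 1 by linarith)
      rwa [Real.rpow_one] at h5
    calc ((c * Δ) ^ 2 + 1) ^ s ≤ (2 * (c * Δ) ^ 2) ^ s := h2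
      _ = 2 ^ s * (c ^ (2 * s) * Δ ^ (2 * s)) := h3
      _ ≤ 2 * (c ^ (2 * s) * Δ ^ (2 * s)) := mul_le_mul_of_nonneg_right h4 (by positivity)
  -- conclusion
  have hΔs : 1 ≤ Δ ^ (2 * s) := Real.one_le_rpow hΔ1 (by linarith)
  have hCE : C * ((c * Δ) ^ 2 + 1) ^ s ≤ C * (2 * (c ^ (2 * s) * Δ ^ (2 * s))) :=
    mul_le_mul_of_nonneg_left hup hC.le
  have hnn : 0 ≤ C * (c ^ (2 * s) * Δ ^ (2 * s)) := by positivity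
  linarith

/-- Height entry of the anchored endgame: if the budget `D ≥ 1` has `D^{max a 0} ≤ A` and
`D^{max b 0} ≤ B`, the exponent `R` satisfies `C A + 2 ≤ R`, and `1 ≤ q ≤ H` with `C B < 2 log q`,
then `H^{−R} < exp(−C(Dᵃ log H + Dᵇ))` (compare exponents:
`C Dᵃ log H + C Dᵇ < C A log H + 2 log H ≤ R log H`). [folklore] -/
theorem anchoredEndgame_height_entry (a b C R A B : ℝ) (D : ℕ) (H q : ℝ) (hC : 0 < C)
    (hD1 : 1 ≤ D) (hDa : (D : ℝ) ^ (max a 0) ≤ A) (hDb : (D : ℝ) ^ (max b 0) ≤ B)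
    (hR : C * A + 2 ≤ R) (hq1 : 1 ≤ q) (hqH : q ≤ H) (hlog : C * B < 2 * Real.log q) :
    H ^ (-R) < Real.exp (-(C * ((D : ℝ) ^ a * Real.log H + (D : ℝ) ^ b))) := by
  have hD1r : (1 : ℝ) ≤ D := by exact_mod_cast hD1
  have hq0 : 0 < q := by linarith
  have hH0 : 0 < H := by linarith
  have hH1 : 1 ≤ H := by linarith
  have hlogH0 : 0 ≤ Real.log H := Real.log_nonneg hH1
  have hlogqH : Real.log q ≤ Real.log H := Real.log_le_log hq0 hqH
  have hDa' : (D : ℝ) ^ a ≤ A :=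
    (Real.rpow_le_rpow_of_exponent_le hD1r (le_max_left _ _)).trans hDa
  have hDb' : (D : ℝ) ^ b ≤ B :=
    (Real.rpow_le_rpow_of_exponent_le hD1r (le_max_left _ _)).trans hDb
  have h1 : C * (D : ℝ) ^ a * Real.log H ≤ C * A * Real.log H := by
    have : C * (D : ℝ) ^ a ≤ C * A := mul_le_mul_of_nonneg_left hDa' hC.le
    exact mul_le_mul_of_nonneg_right this hlogH0
  have h2 : C * (D : ℝ) ^ b ≤ C * B := mul_le_mul_of_nonneg_left hDb' hC.le
  have h3 : (C * A + 2) * Real.log H ≤ R * Real.log H := mul_le_mul_of_nonneg_right hR hlogH0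
  rw [Real.rpow_def_of_pos hH0, Real.exp_lt_exp]
  linarith

/-- Liouville entry of the anchored endgame (real-exponent version of `endgame_liouville_entry`):
for `K ≤ q`, `1 ≤ q ≤ H ≤ q^{M₀}`, `r ≥ 0` and `m ≥ M₀ r + 1`,
`K q^{−m} ≤ q^{1−m} ≤ q^{−M₀ r} = (q^{M₀})^{−r} ≤ H^{−r}`. [folklore] -/
theorem anchoredEndgame_liouville_entry (K M₀ r : ℝ) (m : ℕ) (q H : ℝ) (hKq : K ≤ q)
    (hq1 : 1 ≤ q) (hr : 0 ≤ r) (hm : M₀ * r + 1 ≤ (m : ℝ)) (hqH : q ≤ H) (hH : H ≤ q ^ M₀) :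
    K * (1 / q ^ m) ≤ H ^ (-r) := by
  -- adapted from `endgame_liouville_entry` (…LambertEndgame), exponent `n/200` replaced by `r`
  have hq0 : 0 < q := by linarith
  have hH0 : 0 < H := by linarith
  calc K * (1 / q ^ m) ≤ q * (1 / q ^ m) := by
        apply mul_le_mul_of_nonneg_right hKq
        positivity
    _ = q ^ ((1 : ℝ) - (m : ℝ)) := by
        rw [Real.rpow_sub hq0, Real.rpow_one, Real.rpow_natCast]
        ring
    _ ≤ q ^ (M₀ * (-r)) := by
        apply Real.rpow_le_rpow_of_exponent_le hq1
        linarith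
    _ = (q ^ M₀) ^ (-r) := Real.rpow_mul hq0.le _ _
    _ ≤ H ^ (-r) := Real.rpow_le_rpow_of_nonpos hH0 hH (by linarith)

/-- **STUB 11 (anchored endgame: choice of `Δ`, of the Liouville exponent `m`, and the final
inequality).**  For `a < 1/2`, `C > 0`, `c ≥ 1`, `K ≥ 0`: pick `Δ ≥ c` with
`C((cΔ)² + 1)^{max a 0} + 2 ≤ Δ/c` (`anchoredEndgame_scale`); given `M₀ > 0` put
`m := ⌈M₀Δ/c⌉₊ + 1`, `B := ((cΔ)² + 1)^{max b 0}` and `q₀ := max (max 2 (K + 1)) (exp (C B/2) + 1)`;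
then for `q₀ ≤ q ≤ H ≤ q^{M₀}` and budgets `1 ≤ D ≤ (cΔ)² + 1`:
`C(Dᵃ log H + Dᵇ) < (Δ/c) log H` (`anchoredEndgame_height_entry`) and
`K q^{−m} ≤ q^{−M₀Δ/c} ≤ H^{−Δ/c}` (`anchoredEndgame_liouville_entry`). [folklore] -/
theorem stub_anchoredEndgame :
    ∀ (a b C c K : ℝ), a < 1 / 2 → 0 < C → 1 ≤ c → 0 ≤ K → ∃ Δ : ℝ, c ≤ Δ ∧ ∀ M₀ : ℝ, 0 < M₀ →
      ∃ (m : ℕ) (q₀ : ℝ), ∀ (q H : ℝ) (D : ℕ), q₀ ≤ q → q ≤ H → H ≤ q ^ M₀ → 1 ≤ D →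
        (D : ℝ) ≤ (c * Δ) ^ 2 + 1 →
        max (H ^ (-(Δ / c))) (K * (1 / q ^ m)) <
          Real.exp (-(C * ((D : ℝ) ^ a * Real.log H + (D : ℝ) ^ b))) := by
  intro a b C c K ha hC hc hK
  have ha'0 : 0 ≤ max a 0 := le_max_right _ _
  have ha' : max a 0 < 1 / 2 := max_lt ha (by norm_num)
  obtain ⟨Δ, hcΔ, hscale⟩ := anchoredEndgame_scale (max a 0) C c ha'0 ha' hC hc
  refine ⟨Δ, hcΔ, fun M₀ _hM₀ => ?_⟩
  have hc0 : 0 < c := by linarith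
  have hr0 : 0 ≤ Δ / c := div_nonneg (by linarith) hc0.le
  -- the threshold: q ≥ 2, q ≥ K + 1, log q > C B / 2
  set B : ℝ := ((c * Δ) ^ 2 + 1) ^ (max b 0) with hB
  refine ⟨⌈M₀ * (Δ / c)⌉₊ + 1, max (max 2 (K + 1)) (Real.exp (C * B / 2) + 1),
    fun q H D hq hqH hH hD1 hDle => ?_⟩
  have hq2 : (2 : ℝ) ≤ q := le_trans (le_trans (le_max_left _ _) (le_max_left _ _)) hq
  have hKq : K + 1 ≤ q := le_trans (le_trans (le_max_right _ _) (le_max_left _ _)) hq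
  have hTq : Real.exp (C * B / 2) + 1 ≤ q := le_trans (le_max_right _ _) hq
  have hq0 : 0 < q := by linarith
  have hq1 : 1 ≤ q := by linarith
  -- first entry
  have hlogq : C * B / 2 < Real.log q := by
    rw [Real.lt_log_iff_exp_lt hq0]
    linarith
  have hlog : C * B < 2 * Real.log q := by linarith
  have hD0 : (0 : ℝ) ≤ D := by positivity
  have hDa : (D : ℝ) ^ (max a 0) ≤ ((c * Δ) ^ 2 + 1) ^ (max a 0) :=
    Real.rpow_le_rpow hD0 hDle ha'0
  have hDb : (D : ℝ) ^ (max b 0) ≤ B := Real.rpow_le_rpow hD0 hDle (le_max_right _ _)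
  have hfirst := anchoredEndgame_height_entry a b C (Δ / c) (((c * Δ) ^ 2 + 1) ^ (max a 0)) B D H q
    hC hD1 hDa hDb hscale hq1 hqH hlog
  -- second entry
  have hm : M₀ * (Δ / c) + 1 ≤ ((⌈M₀ * (Δ / c)⌉₊ + 1 : ℕ) : ℝ) := by
    push_cast
    linarith [Nat.le_ceil (M₀ * (Δ / c))]
  have hsecond :=
    anchoredEndgame_liouville_entry K M₀ (Δ / c) _ q H (by linarith) hq1 hr0 hm hqH hH
  exact max_lt hfirst (lt_of_le_of_lt hsecond hfirst)

end Summit.Schanuel.Schanuel.Cruxes.KhovanskiiApproxTypeEv.LambertLiouvilleKill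

end
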